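import Literature.Computability.QuantumComplexity.GramSchmidtRounding
import Literature.Computability.QuantumComplexity.PseudoGaussianSamplerMachine
import Literature.Computability.QuantumComplexity.RoundedGaussianDomination
import Literature.Combinatorics.Enumerative.OverwritePositions
import HarnessLib

/-!
# The Gaussian-extension hiding program of the proof of AA13 Thm. 1.3, as a list program

Family `quantum-advantage`. The `FBPP^{NP^𝒪}` machine of the discharge of Aaronson–Arkhipov's
Thm. 1.3 (`gpeSolvableInFBPPRel_NPRel_of_approxBosonSamplingOracle`) in the tree's finite-precision
form: on the GPE query `⟨n, b, kε, kδ, X̃⟩` and its coins `r = r_S r_B u` it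

1. reads the parameters off `N = n + kε + kδ` (`HPolys`, the polynomials of the machine; every
   number used as a loop bound is clipped by `|r|`, so the program is total and polynomial on ALL
   strings and agrees with the intended one on well-formed queries);
2. decodes the positions `S ∈ [m]ⁿ` (`posL`) and the pseudo-Gaussian integer array `B ∈ (ℤ²)^{m×n}`
   (`coinRowsL`, two runs of the sampler `samplerOf` per entry) from the coin fields;
3. plants the rows of `X̃` into `B` at the positions `S` (`overwriteL` = `overwrite` on rows);
4. computes the rounded exact Gram–Schmidt unit matrix `E = round_{b_q} U`, `U = gsUnit B'`
   (`roundedGS`, `GramSchmidtRounding.lean`), clamped to `[-2^{b_q}, 2^{b_q}]` (`hiddenL`);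
5. assembles the padded oracle query `x' = ⟨⟨n, e, b_q, E⟩, 1^{kβ}⟩`, the counting instance
   `⟨x', S⟩` and the Stockmeyer query `⟨⟨x', S⟩, 1^ℓ, 1^{kη}, 1^{kδS}, u ↾ L_S⟩` (`queryL`, `instL`,
   `stockQueryL` — literally `IdealParams.hidingQuery` / `countInstance` / `countQuery` on lists).

This file holds the LIST-LEVEL definitions and their dictionary with the structured objects of the
analysis (`posL_toList`, `coinRowsL_toList`, `rowsOf_overwrite`, `hiddenL_rowsOf`,
`encode_bosonInput_eq`, `encodeBosonOutcome_eq_listE`); the `CodeFP` certificates are in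
`HidingProgramMachine.lean`, the output stage and the solver in `HidingSolver.lean`.

All proved, no new named facts.

## References

* S. Aaronson, A. Arkhipov, *The computational complexity of linear optics*, Theory of Computing 9
  (2013) 143–252, proof of Thm. 1.3, §5.2 (pp. 192–195), with §2 (p. 161, finite precision) and
  the remark after Lemma 5.8 ("the hiding procedure could be implemented in BPP").
* S. Arora, B. Barak, *Computational Complexity: A Modern Approach*, CUP 2009, §0.1, §7.1.
-/

namespace Literature.Computability.QuantumComplexity

open Polynomial Literature.Computability.Complexity Literature.Computability.Complexity.CodeFP
  Literature.Computability.Cryptography Literature.Probability.Distributions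
  Literature.Combinatorics.Enumerative Literature.Analysis.Matrix

/-! ### The polynomials of the machine and the parameters read off `N = n + kε + kδ` -/

/-- The six polynomials of the hiding machine: the number of modes `m = 2^{size(mP N)}`, the
sampler's acceptance granularity `2^k`, `k = size(kP N)`, its number of attempts `J = JP N`, the
oracle accuracy `kβ`, the counter's accuracy `kη` and confidence `kδS`. [folklore] -/
structure HPolys where
  /-- modes: `m = 2^{size (mP N)}` -/
  mP : Polynomial ℕ
  /-- sampler granularity: `k = size (kP N)` -/
  kP : Polynomial ℕ
  /-- sampler attempts: `J = JP N` -/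
  JP : Polynomial ℕ
  /-- oracle accuracy `kβ = kβP N` -/
  kβP : Polynomial ℕ
  /-- counter accuracy `kη = kηP N` -/
  kηP : Polynomial ℕ
  /-- counter confidence `kδS = kδSP N` -/
  kδSP : Polynomial ℕ

namespace HPolys

variable (H : HPolys)

/-- Range exponent of the sampler: `R = 2^{r₀} ∈ [8(size N + 1), 16(size N + 1)]`. [folklore] -/
def r₀ (N : ℕ) : ℕ := Nat.size (Nat.size N + 1) + 3

/-- `μ = log₂ m`. [folklore] -/
def μ (N : ℕ) : ℕ := Nat.size (H.mP.eval N)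

/-- The number of modes `m = 2^μ`. [folklore] -/
def m (N : ℕ) : ℕ := 2 ^ H.μ N

/-- The sampler's granularity exponent `k`. [folklore] -/
def k (N : ℕ) : ℕ := Nat.size (H.kP.eval N)

/-- The sampler's number of attempts `J`. [folklore] -/
def J (N : ℕ) : ℕ := H.JP.eval N

/-- The oracle accuracy `kβ`. [folklore] -/
def kβ (N : ℕ) : ℕ := H.kβP.eval N

/-- The counter accuracy `kη`. [folklore] -/
def kη (N : ℕ) : ℕ := H.kηP.eval N

/-- The counter confidence `kδS`. [folklore] -/
def kδS (N : ℕ) : ℕ := H.kδSP.eval N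

/-- The sampler's parameters at mesh `2^{-b}`. [folklore] -/
def pg (b N : ℕ) : PGParams := ⟨b, r₀ N, H.k N, H.J N⟩

/-- The query precision `b_q = p₀(m + kβ)` for the oracle's threshold polynomial `p₀`. [folklore] -/
def bq (p₀ : Polynomial ℕ) (N : ℕ) : ℕ := p₀.eval (H.m N + H.kβ N)

/-- `m = 2^μ > mP N`. [folklore] -/
theorem lt_m (N : ℕ) : H.mP.eval N < H.m N := Nat.lt_size_self _

end HPolys

/-! ### The raw input and its clipped scalars -/

/-- The GPE query as a tuple: `(n, b, kε, kδ, rows of X̃)`. [folklore] -/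
abbrev GIn : Type := ℕ × ℕ × ℕ × ℕ × List (List (ℤ × ℤ))

namespace GIn

/-- `n` clipped by the coin length. [folklore] -/
def nC (g : GIn) (r : List Bool) : ℕ := min g.1 r.length

/-- `b` clipped by the coin length. [folklore] -/
def bC (g : GIn) (r : List Bool) : ℕ := min g.2.1 r.length

/-- `N = n + kε + kδ` clipped by the coin length. [folklore] -/
def NC (g : GIn) (r : List Bool) : ℕ := min (g.1 + g.2.2.1 + g.2.2.2.1) r.length

/-- The rows of `X̃`. [folklore] -/
def rows (g : GIn) : List (List (ℤ × ℤ)) := g.2.2.2.2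

/-- On a well-formed query with enough coins the clipped scalars are the true ones. [folklore] -/
theorem nC_eq {g : GIn} {r : List Bool} (h : g.1 + g.2.2.1 + g.2.2.2.1 ≤ r.length) : nC g r = g.1 := by
  unfold nC; omega

/-- On a well-formed query with enough coins the clipped scalars are the true ones. [folklore] -/
theorem NC_eq {g : GIn} {r : List Bool} (h : g.1 + g.2.2.1 + g.2.2.2.1 ≤ r.length) :
    NC g r = g.1 + g.2.2.1 + g.2.2.2.1 := by
  unfold NC; omega

/-- On a well-formed query with enough coins the clipped scalars are the true ones. [folklore] -/
theorem bC_eq {g : GIn} {r : List Bool} (h : g.2.1 ≤ r.length) : bC g r = g.2.1 := by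
  unfold bC; omega

end GIn

/-! ### Stage 2: positions and the sampler array from the coin fields -/

/-- **The positions** `S_0, …, S_{n-1} < 2^μ`: the values of the `n` blocks of `μ` bits. [folklore] -/
def posL (n μ : ℕ) (w : List Bool) : List ℕ :=
  (List.range n).map fun i => bitsToNat ((w.drop (i * μ)).take μ)

/-- One entry from a block of `2 L_c` coins: two sampler runs (cf. `entryOfCoins`). [folklore] -/
def entryPairOf (c : SamplerCtx) (Lc : ℕ) (a : List Bool) : ℤ × ℤ :=
  (samplerOf c (a.take Lc), samplerOf c ((a.drop Lc).take Lc))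

/-- **The sampler array** `B ∈ (ℤ²)^{m×n}` from `m · n · 2L_c` coins, row blocks then entry blocks.
[folklore] -/
def coinRowsL (c : SamplerCtx) (Lc m n : ℕ) (w : List Bool) : List (List (ℤ × ℤ)) :=
  (List.range m).map fun i => (List.range n).map fun j =>
    entryPairOf c Lc ((((w.drop (i * (n * (2 * Lc)))).take (n * (2 * Lc))).drop (j * (2 * Lc))).take (2 * Lc))

/-- `entryPairOf` at the record of `P` is `entryOfCoins P`. [folklore] -/
theorem entryPairOf_ctx (P : PGParams) (a : List Bool) : entryPairOf P.ctx P.coinLen a = entryOfCoins P a := by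
  simp [entryPairOf, entryOfCoins, samplerOf_ctx]

/-- **The positions are `finTuple`** on a coin field of the exact length. [folklore] -/
theorem posL_toList {n μ : ℕ} (v : List.Vector Bool (n * μ)) :
    posL n μ v.toList = List.ofFn fun i : Fin n => ((finTuple v i : Fin (2 ^ μ)) : ℕ) := by
  rw [posL, List.ofFn_eq_map, ← List.map_coe_finRange_eq_range (n := n), List.map_map]
  rfl

variable {m n : ℕ}

/-- **The `m × n` array of the ideal world from coins** (cf. `rowsOfCoins`, the square case). [folklore] -/
def arrOfCoins (P : PGParams) (v : List.Vector Bool (m * (n * (2 * P.coinLen)))) (i : Fin m) (j : Fin n) : ℤ × ℤ :=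
  entryOfCoins P (matChunk v i j).toList

/-- The square case is `rowsOfCoins`. [folklore] -/
theorem arrOfCoins_eq_rowsOfCoins (P : PGParams) (v : List.Vector Bool (n * (n * (2 * P.coinLen)))) :
    arrOfCoins P v = rowsOfCoins P v := rfl

/-- **The sampler array is `arrOfCoins`** on a coin field of the exact length. [folklore] -/
theorem coinRowsL_toList (P : PGParams) (v : List.Vector Bool (m * (n * (2 * P.coinLen)))) :
    coinRowsL P.ctx P.coinLen m n v.toList = rowsOf (arrOfCoins P v) := by
  rw [coinRowsL, rowsOf, List.ofFn_eq_map, ← List.map_coe_finRange_eq_range (n := m), List.map_map]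
  apply List.map_congr_left
  intro i _
  simp only [Function.comp_apply]
  rw [List.ofFn_eq_map, ← List.map_coe_finRange_eq_range (n := n), List.map_map]
  apply List.map_congr_left
  intro j _
  simp only [Function.comp_apply, entryPairOf_ctx]
  rfl

/-! ### Stage 3: planting the rows of `X̃` -/

/-- **Planting on lists**: row `ρ` of the result is the LAST planted row `xs[i]` with `S[i] = ρ`, or
the original row if there is none (= `overwrite`, later plantings win). [folklore] -/
def overwriteL {α : Type*} (B : List (List α)) (S : List ℕ) (xs : List (List α)) : List (List α) :=
  ((List.range B.length).zip B).map fun q =>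
    (List.zipWith (fun s x => (s, x)) S xs).foldl (fun acc sx => if sx.1 = q.1 then sx.2 else acc) q.2

/-- Evaluating a fold of updates at one position. [folklore] -/
theorem foldl_update_apply {α : Type*} {k : ℕ} (S : Fin k → Fin m) (x : Fin k → α) (L : List (Fin k))
    (r : Fin m → α) (ρ : Fin m) :
    (L.foldl (fun acc i => Function.update acc (S i) (x i)) r) ρ =
      L.foldl (fun a i => if S i = ρ then x i else a) (r ρ) := by
  induction L generalizing r with
  | nil => rfl
  | cons i L ih =>
    rw [List.foldl_cons, List.foldl_cons, ih]
    congr 1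
    by_cases h : S i = ρ
    · subst h; simp
    · rw [if_neg h, Function.update_of_ne (Ne.symm h)]

/-- A fold commuting with a map applied to the accumulator. [folklore] -/
theorem foldl_ite_map {α β ι : Type*} (g : α → β) (c : ι → Prop) [DecidablePred c] (x : ι → α)
    (L : List ι) (a : α) :
    L.foldl (fun acc i => if c i then g (x i) else acc) (g a) = g (L.foldl (fun acc i => if c i then x i else acc) a) := by
  induction L generalizing a with
  | nil => rfl
  | cons i L ih =>
    rw [List.foldl_cons, List.foldl_cons]
    by_cases h : c i
    · rw [if_pos h, if_pos h, ih]
    · rw [if_neg h, if_neg h, ih]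

/-- `(range m).zip (ofFn F) = ofFn (ρ ↦ (ρ, F ρ))`. [folklore] -/
theorem range_zip_ofFn {α : Type*} (F : Fin m → α) :
    (List.range m).zip (List.ofFn F) = List.ofFn fun ρ : Fin m => ((ρ : ℕ), F ρ) := by
  apply List.ext_getElem
  · simp
  · intro i h₁ h₂
    simp

/-- `zipWith Prod.mk (ofFn f) (ofFn g) = ofFn (i ↦ (f i, g i))`. [folklore] -/
theorem zipWith_ofFn {α β : Type*} {k : ℕ} (f : Fin k → α) (g : Fin k → β) :
    List.zipWith (fun s x => (s, x)) (List.ofFn f) (List.ofFn g) = List.ofFn fun i => (f i, g i) := by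
  apply List.ext_getElem
  · simp
  · intro i h₁ h₂
    simp

/-- **`overwriteL` on the rows of matrices is `overwrite` on rows.** [folklore] -/
theorem rowsOf_overwrite {k : ℕ} (Bc : Fin m → Fin n → ℤ × ℤ) (S : Fin k → Fin m) (x : Fin k → Fin n → ℤ × ℤ) :
    overwriteL (rowsOf Bc) (List.ofFn fun i => ((S i : Fin m) : ℕ)) (rowsOf x) = rowsOf (overwrite Bc S x) := by
  unfold overwriteL rowsOf
  rw [List.length_ofFn, range_zip_ofFn, zipWith_ofFn,
    List.ofFn_eq_map (f := fun ρ : Fin m => ((ρ : ℕ), List.ofFn fun c => Bc ρ c)), List.map_map,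
    List.ofFn_eq_map (f := fun r => List.ofFn fun c => overwrite Bc S x r c)]
  apply List.map_congr_left
  intro ρ _
  simp only [Function.comp_apply]
  -- the row `ρ` of `overwrite`, as a fold of rows
  have hrow : (fun c => overwrite Bc S x ρ c) =
      (List.finRange k).foldl (fun a i => if S i = ρ then x i else a) (Bc ρ) :=
    foldl_update_apply S x (List.finRange k) Bc ρ
  rw [show (List.ofFn fun c => overwrite Bc S x ρ c) = List.ofFn ((List.finRange k).foldl
      (fun a i => if S i = ρ then x i else a) (Bc ρ)) from congrArg List.ofFn hrow,
    ← foldl_ite_map (fun row : Fin n → ℤ × ℤ => List.ofFn row) (fun i => S i = ρ) x (List.finRange k) (Bc ρ),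
    List.ofFn_eq_map (f := fun i => (((S i : Fin m) : ℕ), List.ofFn fun c => x i c)), List.foldl_map]
  congr 1
  funext acc i
  simp [Fin.val_inj]

/-! ### Stage 4: the clamped rounded Gram–Schmidt unit matrix -/

/-- Clamping an integer to `[-K, K]`. [folklore] -/
def clampZ (K : ℕ) (z : ℤ) : ℤ := max (-(K : ℤ)) (min (K : ℤ) z)

/-- Clamping a pair. [folklore] -/
def clampPair (K : ℕ) (z : ℤ × ℤ) : ℤ × ℤ := (clampZ K z.1, clampZ K z.2)

/-- `|clampZ K z| ≤ K`. [folklore] -/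
theorem abs_clampZ_le (K : ℕ) (z : ℤ) : |clampZ K z| ≤ K := by
  unfold clampZ
  rw [abs_le]
  constructor
  · exact le_max_left _ _
  · exact max_le (by omega) (min_le_left _ _)

/-- Clamping is the identity on `[-K, K]`. [folklore] -/
theorem clampZ_of_abs_le {K : ℕ} {z : ℤ} (h : |z| ≤ K) : clampZ K z = z := by
  unfold clampZ
  rw [abs_le] at h
  rw [min_eq_right h.2, max_eq_right h.1]

/-- **The hidden matrix code**: the rounded exact Gram–Schmidt unit matrix at `b_q` bits, clamped
to `[-2^{b_q}, 2^{b_q}]` (a no-op on a unit column, which keeps the query length polynomial on every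
input). [cite: AaronsonArkhipovToC2013, §5.2 (p. 192) with §2 (p. 161)] -/
def hiddenL (bq : ℕ) (rows : List (List (ℤ × ℤ))) (n : ℕ) : List (List (ℤ × ℤ)) :=
  (roundedGS bq rows n).map fun row => row.map (clampPair (2 ^ bq))

/-- **The hidden matrix of the analysis**: `E = clamp(round_{b_q} U)`, `U = gsUnit (gaussIntMatrix B')`.
[cite: AaronsonArkhipovToC2013, §5.2 (p. 192)] -/
noncomputable def hiddenOf (bq : ℕ) (B : _root_.Matrix (Fin m) (Fin n) (ℤ × ℤ)) (r : Fin m) (c : Fin n) : ℤ × ℤ :=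
  clampPair (2 ^ bq) (roundDyadic bq (gsUnit (gaussIntMatrix B) r c))

/-- **`hiddenL` computes `hiddenOf`** when the columns of `B'` are independent (`roundedGS_rowsOf`).
[cite: AaronsonArkhipovToC2013, §5.2 (p. 192) with §2 (p. 161)] -/
theorem hiddenL_rowsOf (bq : ℕ) (B : _root_.Matrix (Fin m) (Fin n) (ℤ × ℤ))
    (hli : LinearIndependent ℂ (colVec (gaussIntMatrix B))) :
    hiddenL bq (rowsOf B) n = rowsOf (hiddenOf bq B) := by
  rw [hiddenL, roundedGS_rowsOf bq B hli, rowsOf, List.map_ofFn]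
  congr 1
  funext r
  rw [Function.comp_apply, List.map_ofFn]
  rfl

/-- The entries of `hiddenOf` are bounded by `2^{b_q}` in each coordinate. [folklore] -/
theorem abs_hiddenOf_le (bq : ℕ) (B : _root_.Matrix (Fin m) (Fin n) (ℤ × ℤ)) (r : Fin m) (c : Fin n) :
    |(hiddenOf bq B r c).1| ≤ 2 ^ bq ∧ |(hiddenOf bq B r c).2| ≤ 2 ^ bq := by
  have h1 := abs_clampZ_le (2 ^ bq) (roundDyadic bq (gsUnit (gaussIntMatrix B) r c)).1
  have h2 := abs_clampZ_le (2 ^ bq) (roundDyadic bq (gsUnit (gaussIntMatrix B) r c)).2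
  push_cast at h1 h2
  exact ⟨h1, h2⟩

/-- `|round(2ᵇ x)| ≤ 2ᵇ` for `|x| ≤ 1`. [folklore] -/
theorem abs_round_two_pow_mul_le (b : ℕ) {x : ℝ} (hx : |x| ≤ 1) : |round ((2 : ℝ) ^ b * x)| ≤ 2 ^ b := by
  have h2 : (0 : ℝ) < (2 : ℝ) ^ b := by positivity
  rw [abs_le] at hx
  have hy1 : (2 : ℝ) ^ b * x ≤ 2 ^ b := by nlinarith
  have hy2 : -(2 : ℝ) ^ b ≤ (2 : ℝ) ^ b * x := by nlinarith
  have hu := round_le_add_half ((2 : ℝ) ^ b * x)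
  have hl := sub_half_lt_round ((2 : ℝ) ^ b * x)
  have hu' : ((round ((2 : ℝ) ^ b * x) : ℤ) : ℝ) < ((2 ^ b : ℤ) : ℝ) + 1 := by push_cast; linarith
  have hl' : ((-(2 ^ b) : ℤ) : ℝ) - 1 < ((round ((2 : ℝ) ^ b * x) : ℤ) : ℝ) := by push_cast; linarith
  have hu'' : round ((2 : ℝ) ^ b * x) < 2 ^ b + 1 := by exact_mod_cast hu'
  have hl'' : -(2 ^ b) - 1 < round ((2 : ℝ) ^ b * x) := by exact_mod_cast hl'
  rw [abs_le]
  exact ⟨Int.sub_one_lt_iff.mp hl'', Int.lt_add_one_iff.mp hu''⟩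

/-- **On a column-orthonormal `U` the clamping is a no-op**: `hiddenOf = roundEntries b_q U`.
[cite: AaronsonArkhipovToC2013, §5.2 (p. 192)] -/
theorem hiddenOf_eq_roundEntries (bq : ℕ) (B : _root_.Matrix (Fin m) (Fin n) (ℤ × ℤ))
    (hU : ∀ r c, ‖gsUnit (gaussIntMatrix B) r c‖ ≤ 1) :
    hiddenOf bq B = fun r c => roundEntries bq (gsUnit (gaussIntMatrix B)) r c := by
  funext r c
  have hre : |(gsUnit (gaussIntMatrix B) r c).re| ≤ 1 := (Complex.abs_re_le_norm _).trans (hU r c)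
  have him : |(gsUnit (gaussIntMatrix B) r c).im| ≤ 1 := (Complex.abs_im_le_norm _).trans (hU r c)
  simp only [hiddenOf, clampPair, roundEntries, roundDyadic]
  rw [clampZ_of_abs_le (by exact_mod_cast abs_round_two_pow_mul_le bq hre),
    clampZ_of_abs_le (by exact_mod_cast abs_round_two_pow_mul_le bq him)]

/-! ### Stage 5: the oracle query, the counting instance, the Stockmeyer query -/

/-- **The padded oracle query on lists**: `⟨⟨n, e, b_q, E⟩, 1^{kβ}⟩` (`IdealParams.hidingQuery`). [cite: AaronsonArkhipovToC2013, proof of Thm. 1.3 (p. 193)] -/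
def queryL (n e bq kβ : ℕ) (E : List (List (ℤ × ℤ))) : List Bool :=
  boolPair (boolPair (natE n) (boolPair (natE e) (boolPair (natE bq) (listE (listE (pairE smE smE)) E))))
    (unE kβ)

/-- **The counting instance on lists**: `⟨x', S⟩` with the outcome code of the positions
(`IdealParams.countInstance`). [cite: AaronsonArkhipovToC2013, proof of Thm. 1.3, eq. (5.80) (p. 193)] -/
def instL (x' : List Bool) (S : List ℕ) : List Bool := boolPair x' (listE natE S)

/-- Re-indexing a list code along a map of the items. [folklore] -/
theorem listE_map {α β : Type} (e : β → List Bool) (f : α → β) (l : List α) :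
    listE e (l.map f) = listE (e ∘ f) l := by
  simp [listE, rawE, List.map_map]

/-- The code of a BosonSampling instance, spelled out. [folklore] -/
theorem encode_bosonInput_eq {e : ℕ} (b : ℕ) (E : Fin (n + e) → Fin n → ℤ × ℤ) :
    encodingBosonInput.encode ⟨n, e, b, E⟩ =
      boolPair (natE n) (boolPair (natE e) (boolPair (natE b) (listE (listE (pairE smE smE)) (rowsOf E)))) := by
  simp only [encodingBosonInput, Computability.Encoding.sigmaBool, Computability.Encoding.pairBool, encodingFinVec,
    listE_eq]
  rw [rowsOf, show (List.ofFn fun r => List.ofFn (E r)) = (List.ofFn E).map (fun v => List.ofFn v) by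
    rw [List.map_ofFn]; rfl, listE_map]
  rfl

/-- **`queryL` is `hidingQuery`.** [cite: AaronsonArkhipovToC2013, proof of Thm. 1.3 (p. 193)] -/
theorem queryL_rowsOf (P : IdealParams) {e : ℕ} (E : Fin (n + e) → Fin n → ℤ × ℤ) :
    queryL n e P.b' P.kβ (rowsOf E) = P.hidingQuery E := by
  rw [IdealParams.hidingQuery, encode_bosonInput_eq]
  rfl

/-- The outcome code of positions, spelled out. [folklore] -/
theorem encodeBosonOutcome_eq_listE (s : Fin n → Fin m) :
    encodeBosonOutcome s = listE natE (List.ofFn fun i => ((s i : Fin m) : ℕ)) := by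
  rw [encodeBosonOutcome, encodingFinVec]
  simp only [listE_eq]
  rw [show (List.ofFn fun i => ((s i : Fin m) : ℕ)) = (List.ofFn s).map Fin.val by
    rw [List.map_ofFn]; rfl, listE_map]
  rfl

/-- **`instL` is `countInstance`** at an injective position. [cite: AaronsonArkhipovToC2013, proof of Thm. 1.3, eq. (5.80) (p. 193)] -/
theorem instL_eq_countInstance (P : IdealParams) {e : ℕ} (E : Fin (n + e) → Fin n → ℤ × ℤ) (ι : Fin n ↪ Fin (n + e)) :
    instL (queryL n e P.b' P.kβ (rowsOf E)) (List.ofFn fun i => ((ι i : Fin (n + e)) : ℕ)) = P.countInstance E ι := by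
  rw [instL, queryL_rowsOf, IdealParams.countInstance, plantedOutcome, encodeBosonOutcome_eq_listE]

/-! ### Stage 6: the output arithmetic -/

/-- The `d`'s of Cohen's table of the planted array: `d_l` for `l < 2n` (`d_l ≤ 0 ↦` junk). [folklore] -/
def dOfL (rows : List (List (ℤ × ℤ))) (n l : ℕ) : ℤ :=
  ((gsLevels rows n (rows.length + rows.length)).getD l (0, [])).1

/-- `∏_{c<n} d_{2c+1}` (numerators of `∏ ‖b*_c‖² = ∏ d_{2c+1}/d_{2c}`). [folklore] -/
def dProdOdd (rows : List (List (ℤ × ℤ))) (n : ℕ) : ℤ := ((List.range n).map fun c => dOfL rows n (2 * c + 1)).prod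

/-- `∏_{c<n} d_{2c}` (denominators of `∏ ‖b*_c‖²`). [folklore] -/
def dProdEven (rows : List (List (ℤ × ℤ))) (n : ℕ) : ℤ := ((List.range n).map fun c => dOfL rows n (2 * c)).prod

/-- **The list `d`'s are Cohen's `dRec` of the extended family** of the planted matrix. [folklore] -/
theorem dOfL_rowsOf (B : Fin m → Fin n → ℤ × ℤ) {l : ℕ} (hl : l < 2 * n) :
    dOfL (rowsOf B) n l = Literature.Algebra.EuclideanLattices.dRec (extFamily B) l := by
  have hm : (rowsOf B).length = m := List.length_ofFn
  rw [dOfL, hm, getD_gsLevels _ _ _ hl, extRowsL_rowsOf]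
  exact dList_ofFn _ (by rw [min_eq_left (Nat.le_add_right _ _)]; omega)

/-- `∏_{c<n} d_{2c+1} = ∏_c dRec (2c+1)`. [folklore] -/
theorem dProdOdd_rowsOf (B : Fin m → Fin n → ℤ × ℤ) :
    dProdOdd (rowsOf B) n = ∏ c : Fin n, Literature.Algebra.EuclideanLattices.dRec (extFamily B) (2 * c + 1) := by
  rw [dProdOdd, ← List.map_coe_finRange_eq_range (n := n), List.map_map, ← List.ofFn_eq_map, List.prod_ofFn]
  exact Finset.prod_congr rfl fun c _ => dOfL_rowsOf B (by dsimp only; omega)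

/-- `∏_{c<n} d_{2c} = ∏_c dRec (2c)`. [folklore] -/
theorem dProdEven_rowsOf (B : Fin m → Fin n → ℤ × ℤ) :
    dProdEven (rowsOf B) n = ∏ c : Fin n, Literature.Algebra.EuclideanLattices.dRec (extFamily B) (2 * c) := by
  rw [dProdEven, ← List.map_coe_finRange_eq_range (n := n), List.map_map, ← List.ofFn_eq_map, List.prod_ofFn]
  exact Finset.prod_congr rfl fun c _ => dOfL_rowsOf B (by dsimp only; omega)

/-- **The integer answer** `z = ⌊4ᵇ · n! · Ñ · ∏ d_odd / (2^ℓ · 4^{bn} · ∏ d_even)⌋`, so that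
`z/4ᵇ ≈ n! · (Ñ/2^ℓ) · ∏‖b*_c‖² / 4^{bn} ≈ |Per(X̃/2ᵇ)|²` (natural division; `0` on junk). [cite: AaronsonArkhipovToC2013, proof of Thm. 1.3, eqs. (5.89), (5.93) (pp. 194–195)] -/
def zOf (b n N ℓ : ℕ) (dodd deven : ℤ) : ℕ :=
  (4 ^ b * n.factorial * N * dodd.toNat) / (2 ^ ℓ * 4 ^ (b * n) * deven.toNat)

/-! ### The two string functions of the machine -/

section Top

variable (H : HPolys) (p₀ cO cS : Polynomial ℕ)

/-- The sampler parameters used on input `(g, r)`: mesh `2^{-b}` at the input precision. [folklore] -/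
def pgOf (g : GIn) (r : List Bool) : PGParams := H.pg (g.bC r) (g.NC r)

/-- The coin field of the positions. [folklore] -/
def coinsS (g : GIn) (r : List Bool) : List Bool := r.take (g.nC r * H.μ (g.NC r))

/-- The coin field of the sampler array. [folklore] -/
def coinsB (g : GIn) (r : List Bool) : List Bool :=
  (r.drop (g.nC r * H.μ (g.NC r))).take (H.m (g.NC r) * (g.nC r * (2 * (pgOf H g r).coinLen)))

/-- The coin field of the counter (all remaining coins). [folklore] -/
def coinsU (g : GIn) (r : List Bool) : List Bool :=
  r.drop (g.nC r * H.μ (g.NC r) + H.m (g.NC r) * (g.nC r * (2 * (pgOf H g r).coinLen)))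

/-- The positions. [folklore] -/
def posTop (g : GIn) (r : List Bool) : List ℕ := posL (g.nC r) (H.μ (g.NC r)) (coinsS H g r)

/-- **The planted array `B'`.** [cite: AaronsonArkhipovToC2013, proof of Thm. 1.3 (p. 194)] -/
def plantedTop (g : GIn) (r : List Bool) : List (List (ℤ × ℤ)) :=
  overwriteL (coinRowsL (pgOf H g r).ctx (pgOf H g r).coinLen (H.m (g.NC r)) (g.nC r) (coinsB H g r))
    (posTop H g r) g.rows

/-- **The hidden matrix code `E`.** [cite: AaronsonArkhipovToC2013, §5.2 (p. 192)] -/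
def hiddenTop (g : GIn) (r : List Bool) : List (List (ℤ × ℤ)) :=
  hiddenL (H.bq p₀ (g.NC r)) (plantedTop H g r) (g.nC r)

/-- **The padded oracle query `x'`.** [cite: AaronsonArkhipovToC2013, proof of Thm. 1.3 (p. 193)] -/
def queryTop (g : GIn) (r : List Bool) : List Bool :=
  queryL (g.nC r) (H.m (g.NC r) - g.nC r) (H.bq p₀ (g.NC r)) (H.kβ (g.NC r)) (hiddenTop H p₀ g r)

/-- **The counting instance `⟨x', S⟩`.** [cite: AaronsonArkhipovToC2013, proof of Thm. 1.3, eq. (5.80) (p. 193)] -/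
def instTop (g : GIn) (r : List Bool) : List Bool := instL (queryTop H p₀ g r) (posTop H g r)

/-- The oracle's coin length `ℓ = c_𝒪(|x'|)` at the query. [cite: AaronsonArkhipovToC2013, Def. 3.11 (p. 174)] -/
def ellTop (g : GIn) (r : List Bool) : ℕ := cO.eval (queryTop H p₀ g r).length

/-- The counter's coin demand `L_S = c_S(|⟨x', S⟩| + ℓ + kη + kδS)`. [cite: AaronsonArkhipovToC2013, Thm. 4.1 (p. 175)] -/
def sclTop (g : GIn) (r : List Bool) : ℕ :=
  cS.eval ((instTop H p₀ g r).length + ellTop H p₀ cO g r + H.kη (g.NC r) + H.kδS (g.NC r))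

/-- **The pre-processing `pre`: the Stockmeyer query `⟨⟨x', S⟩, 1^ℓ, 1^{kη}, 1^{kδS}, u ↾ L_S⟩`.**
[cite: AaronsonArkhipovToC2013, proof of Thm. 1.3, eq. (5.89) (p. 194) with Thm. 4.1 (p. 175)] -/
def preFun (q : GIn × List Bool) : List Bool :=
  countQuery (instTop H p₀ q.1 q.2) (ellTop H p₀ cO q.1 q.2) (H.kη (q.1.NC q.2)) (H.kδS (q.1.NC q.2))
    ((coinsU H q.1 q.2).take (sclTop H p₀ cO cS q.1 q.2))

/-- **The post-processing `post`: the integer answer** from the input and the counter's reply `y`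
(`Ñ = decodeNat y`); `4ᵇ` (the exact answer) in dimension `0`. [cite: AaronsonArkhipovToC2013, proof of Thm. 1.3, eq. (5.93) (p. 195)] -/
def postFun (q : (GIn × List Bool) × List Bool) : ℤ :=
  if q.1.1.nC q.1.2 = 0 then ((4 ^ q.1.1.bC q.1.2 : ℕ) : ℤ)
  else (zOf (q.1.1.bC q.1.2) (q.1.1.nC q.1.2) (Computability.decodeNat q.2) (ellTop H p₀ cO q.1.1 q.1.2)
      (dProdOdd (plantedTop H q.1.1 q.1.2) (q.1.1.nC q.1.2)) (dProdEven (plantedTop H q.1.1 q.1.2) (q.1.1.nC q.1.2)) : ℤ)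

end Top

end Literature.Computability.QuantumComplexity
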